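import Literature.AnabelianGeometry.SemiGraphs.ArithTowerTrans
import Literature.AnabelianGeometry.SemiGraphs.TemperedPiLevelKernelVerticial
import Literature.AnabelianGeometry.SemiGraphs.TemperedCompactInVerticialCpt
import Literature.AnabelianGeometry.SemiGraphs.TemperedPiChartExists
import HarnessLib

/-!
# [SemiAnbd] Thm 3.7 (iii) p. 41 / Thm 5.4 (i) p. 66: the estrangement consequence «no compact `C ≠ 1` fixes a
# compatible branch-pair system» at the COSET-GRAPH levels `ker π_n` of the Galois tower (producer of the
# capstone binder `hnobpNCpt`; proof-only)

Mochizuki, *Semi-graphs of anabelioids*, Publ. RIMS **42** (2006), §3, proof of Thm. 3.7 (iii) p. 41 ("since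
`𝒢` is totally estranged, `H` fixes precisely one branch of `v_j`"), §5 Thm. 5.4 (i) p. 66
[cite: MochizukiSemiAnbd2006, Thm 3.7(iii) p.41].

PROOF-ONLY (cell abc-iut, layer L3, row «T54-B hnobpNCpt-PRODUCER», L3-lead ruling α29 (2), seat
abc-iut-w4-d083; no definition).  The compact-form capstone `ArithLevelDataCpt.ofCosetTowerC`
(abc-iut-w4-d029 / abc-iut-w4-d059) binds `hnobpNCpt`: at the finite COSET levels
`P.cosetGraph (L n)` of the presentation `P = D.piPresentation` of `𝔾` in `π₁^temp(𝒢)`, with the ARITHMETIC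
actions `P.arithAct hP (L n) _ (ι γ)`, a compact `C ≤ π₁^temp(𝒢)` fixing a compatible system
`(w_i; β_i ≠ β'_i)` of a vertex with two abutting branches is trivial.  Here, for the level family
`L n := ker π_n` (abc-iut-L3-d4's `piLevelAut`, `levelCosetIso n : P.cosetGraph (ker π_n) ≅ 𝔾_{S n}`):
* (`GaloisLevelData.levelCosetIso_levelTrans` of `ArithTowerTrans.lean`, row T54-B file T3e-4 — the
  identifications intertwine ALL transitions `cosetGraphTrans (ker π_j ≤ ker π_i)` with abc-iut-L3-t6's
  `levelTrans (i ≤ j)` — is consumed by name);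
* `GaloisLevelData.hnobpCpt_cosetLevels_of_orbitLevels` — TRANSPORT: the statement at the ORBIT levels
  `𝔾_{S n}` (t6's `levelAct`, `levelTrans`) implies the statement at the coset levels `ker π_n` with the
  arithmetic actions through `ι` (a fixed system is pushed along `levelCosetIso`; distinctness / abutment by the
  isomorphism, compatibility by `levelCosetIso_levelTrans` (T3e-4), fixedness by d4's `deckAct_comp_levelCosetIso` and
  d4's `arithAct_eq_deckAct_of_inner`);
* `GaloisLevelData.hnobpCpt_orbitLevels_of_stabBranchPairCpt'` — at the orbit levels the statement follows
  from the compact-form branch identification (I4′)_cpt (the INPUT text `stabBranchPairCpt'` of abc-iut-L3-t8's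
  `finiteLevelDataCptOfTower`, produced by the (β)-chain) by abc-iut-L3-t11's
  `noFixedBranchPairSystem_of_isTotallyEstranged_cpt` (total estrangement, Thm 3.7 hypotheses);
* **`hnobpNCpt_cosetTower`** — the capstone binder text at the CANONICAL tower (`𝒢.galoisLevelData h36`,
  chart `𝒢.temperedPiChart h36`, `L n := ker π_n`, `hL := ker_piLevelAut_anti`) from (I4′)_cpt at the orbit
  levels.
Nothing here asserts (I4′)_cpt; nothing here bears on [IUTchIII] Cor. 3.12; typed ≠ proved.
-/

namespace Literature.AnabelianGeometry.SemiGraphs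

namespace ProfiniteSemiGraph

open CategoryTheory Topology

universe u v

namespace GaloisLevelData

variable {𝒢 : ProfiniteSemiGraph.{u}} (D : GaloisLevelData 𝒢) (h𝒢 : 𝒢.IsCountable)
  (hconn : ∀ (n : ℕ) (p q : (D.S n).Point), (D.S n).SameComponent p q)
  (T : ∀ w : 𝒢.graph.Vertex, D.PointSeq h𝒢 w) (R : SemiGraph.RefBranches 𝒢.graph)

/-- The `inv` of the identification undoes the `hom` on branches. [folklore] -/
private theorem levelCosetIso_inv_branchMap_hom (n : ℕ)
    (β : ((D.piPresentation h𝒢 T R).cosetGraph (D.piLevelAut h𝒢 hconn n).ker).Branch) :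
    (D.levelCosetIso h𝒢 hconn T R n).inv.branchMap ((D.levelCosetIso h𝒢 hconn T R n).hom.branchMap β) = β := by
  have h := congrArg (fun φ => SemiGraph.Hom.branchMap φ β) (D.levelCosetIso h𝒢 hconn T R n).hom_inv_id
  simp only [SemiGraph.comp_branchMap, SemiGraph.id_branchMap, Function.comp_apply, id_eq] at h
  exact h

/-! ### Transport of the estrangement consequence from the orbit levels to the coset levels -/

/-- **Transport along `levelCosetIso`**: if at the ORBIT levels `𝔾_{S n}` (abc-iut-L3-t6's `levelAct`,
`levelTrans`) no compact `C ≠ 1` of `π₁^temp(𝒢)` fixes a compatible system of a vertex with two distinct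
abutting branches, then the same holds at the COSET levels `P.cosetGraph (ker π_n)` for the arithmetic actions
`P.arithAct hP (ker π_n) _ (ι γ)` of an arithmetic group `E ⊇ ι(π₁^temp(𝒢))` acting compatibly (`hP`, inner on
`π₁^temp(𝒢)`: `hιΦ`, trivially on `𝔾`: `hισ`).  [cite: MochizukiSemiAnbd2006, Thm 5.4 (i), p. 66] -/
theorem hnobpCpt_cosetLevels_of_orbitLevels {E : Type v} [Group E]
    {Φ : E →* MulAut (D.temperedPi h𝒢)} {σ : E →* Aut 𝒢.graph}
    (hP : (D.piPresentation h𝒢 T R).IsArithCompatible Φ σ)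
    (hN : ∀ (n : ℕ) (e : E) (x : D.temperedPi h𝒢),
      x ∈ (D.piLevelAut h𝒢 hconn n).ker → Φ e x ∈ (D.piLevelAut h𝒢 hconn n).ker)
    (ι : D.temperedPi h𝒢 →* E) (hιΦ : ∀ g, Φ (ι g) = MulAut.conj g) (hισ : ∀ g, σ (ι g) = 1)
    (horbit : ∀ (C : Subgroup (D.temperedPi h𝒢)), IsCompact (C : Set (D.temperedPi h𝒢)) →
      ∀ (j₀ : ℕ) (w : ∀ i : {i : ℕ // j₀ ≤ i}, (D.S i.1).orbitGraph.Vertex)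
      (β β' : ∀ i : {i : ℕ // j₀ ≤ i}, (D.S i.1).orbitGraph.Branch),
      (∀ i, β i ≠ β' i ∧ (D.S i.1).orbitGraph.abuts (β i) = some (w i) ∧
        (D.S i.1).orbitGraph.abuts (β' i) = some (w i)) →
      (∀ ⦃i i' : {i : ℕ // j₀ ≤ i}⦄ (h : i.1 ≤ i'.1), (D.levelTrans h).vertexMap (w i') = w i ∧
        (D.levelTrans h).branchMap (β i') = β i ∧ (D.levelTrans h).branchMap (β' i') = β' i) →
      (∀ (i : {i : ℕ // j₀ ≤ i}) (γ : C), (D.levelAct h𝒢 hconn i.1 γ).hom.vertexMap (w i) = w i ∧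
        (D.levelAct h𝒢 hconn i.1 γ).hom.branchMap (β i) = β i ∧
          (D.levelAct h𝒢 hconn i.1 γ).hom.branchMap (β' i) = β' i) → C = ⊥) :
    ∀ (C : Subgroup (D.temperedPi h𝒢)), IsCompact (C : Set (D.temperedPi h𝒢)) →
      ∀ (j₀ : ℕ) (w : ∀ i : {i : ℕ // j₀ ≤ i},
        ((D.piPresentation h𝒢 T R).cosetGraph (D.piLevelAut h𝒢 hconn i.1).ker).Vertex)
      (β β' : ∀ i : {i : ℕ // j₀ ≤ i},
        ((D.piPresentation h𝒢 T R).cosetGraph (D.piLevelAut h𝒢 hconn i.1).ker).Branch),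
      (∀ i, β i ≠ β' i ∧
        ((D.piPresentation h𝒢 T R).cosetGraph (D.piLevelAut h𝒢 hconn i.1).ker).abuts (β i) = some (w i) ∧
        ((D.piPresentation h𝒢 T R).cosetGraph (D.piLevelAut h𝒢 hconn i.1).ker).abuts (β' i) =
          some (w i)) →
      (∀ ⦃i i' : {i : ℕ // j₀ ≤ i}⦄ (h : i.1 ≤ i'.1),
        ((D.piPresentation h𝒢 T R).cosetGraphTrans (D.ker_piLevelAut_anti h𝒢 hconn h)).vertexMap (w i') =
            w i ∧
          ((D.piPresentation h𝒢 T R).cosetGraphTrans (D.ker_piLevelAut_anti h𝒢 hconn h)).branchMap (β i') =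
            β i ∧
          ((D.piPresentation h𝒢 T R).cosetGraphTrans (D.ker_piLevelAut_anti h𝒢 hconn h)).branchMap (β' i') =
            β' i) →
      (∀ (i : {i : ℕ // j₀ ≤ i}) (γ : C),
        ((D.piPresentation h𝒢 T R).arithAct hP (D.piLevelAut h𝒢 hconn i.1).ker (hN i.1) (ι γ)).hom.vertexMap
            (w i) = w i ∧
        ((D.piPresentation h𝒢 T R).arithAct hP (D.piLevelAut h𝒢 hconn i.1).ker (hN i.1) (ι γ)).hom.branchMap
            (β i) = β i ∧
        ((D.piPresentation h𝒢 T R).arithAct hP (D.piLevelAut h𝒢 hconn i.1).ker (hN i.1) (ι γ)).hom.branchMap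
            (β' i) = β' i) → C = ⊥ := by
  intro C hC j₀ w β β' hpair hcompat hfix
  -- push the system along the identifications `levelCosetIso`
  let I : ∀ n : ℕ, (D.piPresentation h𝒢 T R).cosetGraph (D.piLevelAut h𝒢 hconn n).ker ≅ (D.S n).orbitGraph :=
    fun n => D.levelCosetIso h𝒢 hconn T R n
  refine horbit C hC j₀ (fun i => (I i.1).hom.vertexMap (w i)) (fun i => (I i.1).hom.branchMap (β i))
    (fun i => (I i.1).hom.branchMap (β' i)) (fun i => ⟨fun h => (hpair i).1 ?_,
      (I i.1).hom.abuts_branchMap _ _ (hpair i).2.1, (I i.1).hom.abuts_branchMap _ _ (hpair i).2.2⟩)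
    (fun i i' h => ?_) (fun i γ => ?_)
  · -- distinct branches stay distinct
    rw [← D.levelCosetIso_inv_branchMap_hom h𝒢 hconn T R i.1 (β i), h,
      D.levelCosetIso_inv_branchMap_hom h𝒢 hconn T R i.1 (β' i)]
  · -- compatibility with the transitions
    have hsq := D.levelCosetIso_levelTrans h𝒢 hconn T R h
    have hv := congrArg (fun φ => SemiGraph.Hom.vertexMap φ (w i')) hsq
    have hb := congrArg (fun φ => SemiGraph.Hom.branchMap φ (β i')) hsq
    have hb' := congrArg (fun φ => SemiGraph.Hom.branchMap φ (β' i')) hsq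
    simp only [SemiGraph.comp_vertexMap, SemiGraph.comp_branchMap, Function.comp_apply] at hv hb hb'
    refine ⟨?_, ?_, ?_⟩
    · rw [hv, (hcompat h).1]
    · rw [hb, (hcompat h).2.1]
    · rw [hb', (hcompat h).2.2]
  · -- fixedness: `arithAct (ι γ) = deckAct γ` is intertwined with `levelAct γ`
    have hsq := D.deckAct_comp_levelCosetIso h𝒢 hconn T R i.1 (γ : D.temperedPi h𝒢)
    rw [← (D.piPresentation h𝒢 T R).arithAct_eq_deckAct_of_inner hP (D.piLevelAut h𝒢 hconn i.1).ker
      (hN i.1) (hιΦ γ) (hισ γ)] at hsq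
    have hv := congrArg (fun φ => SemiGraph.Hom.vertexMap φ (w i)) hsq
    have hb := congrArg (fun φ => SemiGraph.Hom.branchMap φ (β i)) hsq
    have hb' := congrArg (fun φ => SemiGraph.Hom.branchMap φ (β' i)) hsq
    simp only [SemiGraph.comp_vertexMap, SemiGraph.comp_branchMap, Function.comp_apply] at hv hb hb'
    refine ⟨?_, ?_, ?_⟩
    · rw [← hv, (hfix i γ).1]
    · rw [← hb, (hfix i γ).2.1]
    · rw [← hb', (hfix i γ).2.2]

/-! ### The orbit-level statement from (I4′)_cpt -/

/-- **At the orbit levels `𝔾_{S n}`, (I4′)_cpt gives the estrangement consequence** (the input text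
`stabBranchPairCpt'` of abc-iut-L3-t8's `finiteLevelDataCptOfTower`, for a chart `c` acting through
`ρ : π₁^temp(c) → π₁^temp(𝒢)_D`, fed to abc-iut-L3-t11's `noFixedBranchPairSystem_of_isTotallyEstranged_cpt`):
no compact `C ≠ 1` fixes a compatible branch-pair system. [cite: MochizukiSemiAnbd2006, Thm 3.7(iii) p.41] -/
theorem hnobpCpt_orbitLevels_of_stabBranchPairCpt' (h37 : 𝒢.Thm37Hypotheses) (c : TemperedPiChart 𝒢)
    (ρ : c.G →* D.temperedPi h𝒢)
    (stabBranchPairCpt' : ∀ (C : Subgroup c.G), IsCompact (C : Set c.G) →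
      ∀ (j₀ : ℕ) (w : ∀ i : {i : ℕ // j₀ ≤ i}, (D.S i.1).orbitGraph.Vertex)
      (β β' : ∀ i : {i : ℕ // j₀ ≤ i}, (D.S i.1).orbitGraph.Branch),
      (∀ i, β i ≠ β' i ∧ (D.S i.1).orbitGraph.abuts (β i) = some (w i) ∧
        (D.S i.1).orbitGraph.abuts (β' i) = some (w i)) →
      (∀ ⦃i i' : {i : ℕ // j₀ ≤ i}⦄ (h : i.1 ≤ i'.1), (D.levelTrans h).vertexMap (w i') = w i ∧
        (D.levelTrans h).branchMap (β i') = β i ∧ (D.levelTrans h).branchMap (β' i') = β' i) →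
      ∃ (Q : Type u) (_ : Group Q) (ιQ : c.G →* Q) (v : 𝒢.graph.Vertex) (b b' : 𝒢.graph.Branch)
        (hb : 𝒢.graph.abuts b = some v) (hb' : 𝒢.graph.abuts b' = some v) (ψ : 𝒢.Gv v →* Q)
        (x x' : 𝒢.Gv v),
        Set.InjOn ιQ C ∧ Function.Injective ψ ∧ (b' ≠ b ∨ x⁻¹ * x' ∉ 𝒢.branchSubgroup b v hb) ∧
        ∀ g ∈ C, (∀ i, (D.levelAct h𝒢 hconn i.1 (ρ g)).hom.vertexMap (w i) = w i ∧
          (D.levelAct h𝒢 hconn i.1 (ρ g)).hom.branchMap (β i) = β i ∧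
          (D.levelAct h𝒢 hconn i.1 (ρ g)).hom.branchMap (β' i) = β' i) →
          ιQ g ∈ ((𝒢.branchSubgroup b v hb).map (MulAut.conj x).toMonoidHom).map ψ ⊓
            ((𝒢.branchSubgroup b' v hb').map (MulAut.conj x').toMonoidHom).map ψ) :
    ∀ (C : Subgroup c.G), IsCompact (C : Set c.G) →
      ∀ (j₀ : ℕ) (w : ∀ i : {i : ℕ // j₀ ≤ i}, (D.S i.1).orbitGraph.Vertex)
      (β β' : ∀ i : {i : ℕ // j₀ ≤ i}, (D.S i.1).orbitGraph.Branch),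
      (∀ i, β i ≠ β' i ∧ (D.S i.1).orbitGraph.abuts (β i) = some (w i) ∧
        (D.S i.1).orbitGraph.abuts (β' i) = some (w i)) →
      (∀ ⦃i i' : {i : ℕ // j₀ ≤ i}⦄ (h : i.1 ≤ i'.1), (D.levelTrans h).vertexMap (w i') = w i ∧
        (D.levelTrans h).branchMap (β i') = β i ∧ (D.levelTrans h).branchMap (β' i') = β' i) →
      (∀ (i : {i : ℕ // j₀ ≤ i}) (γ : C), (D.levelAct h𝒢 hconn i.1 (ρ γ)).hom.vertexMap (w i) = w i ∧
        (D.levelAct h𝒢 hconn i.1 (ρ γ)).hom.branchMap (β i) = β i ∧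
          (D.levelAct h𝒢 hconn i.1 (ρ γ)).hom.branchMap (β' i) = β' i) → C = ⊥ :=
  fun C hC => noFixedBranchPairSystem_of_isTotallyEstranged_cpt h37 c (fun n => (D.S n).orbitGraph)
    (fun n => (D.levelAct h𝒢 hconn n).comp ρ) (fun _ _ h => D.levelTrans h) C (stabBranchPairCpt' C hC)

end GaloisLevelData

/-! ### The capstone binder `hnobpNCpt` at the canonical tower -/

variable {𝒢 : ProfiniteSemiGraph.{u}}

/-- **The capstone binder `hnobpNCpt` of `ArithLevelDataCpt.ofCosetTowerC` AT THE CANONICAL TOWER**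
(`𝒢.galoisLevelData h36`, chart `𝒢.temperedPiChart h36` with `π₁^temp(𝒢) = lim_n Gal(𝒢_{∞,n}/𝒢)`,
presentation `piPresentation T R`, finite levels `L n := ker π_n`, `hL := ker_piLevelAut_anti`,
`hLst := hN`), FROM the compact-form branch identification (I4′)_cpt at the orbit levels `𝔾_{S n}` (the
(β)-chain's product, input text of `finiteLevelDataCptOfTower` at `ρ = id`): a compact `C ≤ π₁^temp(𝒢)` fixing,
through the arithmetic actions `arithAct hP (ker π_n) _ (ι γ)`, a compatible system of a vertex with two
distinct abutting branches of the coset semi-graphs is trivial — by total estrangement (Thm 3.7 hypotheses).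
[cite: MochizukiSemiAnbd2006, Thm 5.4 (i), p. 66] -/
theorem hnobpNCpt_cosetTower (h36 : 𝒢.Prop36Hypotheses) (h37 : 𝒢.Thm37Hypotheses)
    (hconn : ∀ (n : ℕ) (p q : ((𝒢.galoisLevelData h36).S n).Point),
      ((𝒢.galoisLevelData h36).S n).SameComponent p q)
    (T : ∀ w : 𝒢.graph.Vertex, (𝒢.galoisLevelData h36).PointSeq h36.isCountable w)
    (R : SemiGraph.RefBranches 𝒢.graph) {E : Type v} [Group E]
    {Φ : E →* MulAut (𝒢.temperedPiChart h36).G} {σ : E →* Aut 𝒢.graph}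
    (hP : ((𝒢.galoisLevelData h36).piPresentation h36.isCountable T R).IsArithCompatible Φ σ)
    (hN : ∀ (n : ℕ) (e : E) (x : (𝒢.temperedPiChart h36).G),
      x ∈ ((𝒢.galoisLevelData h36).piLevelAut h36.isCountable hconn n).ker →
        Φ e x ∈ ((𝒢.galoisLevelData h36).piLevelAut h36.isCountable hconn n).ker)
    (ι : (𝒢.temperedPiChart h36).G →* E) (hιΦ : ∀ g, Φ (ι g) = MulAut.conj g) (hισ : ∀ g, σ (ι g) = 1)
    (stabBranchPairCpt' : ∀ (C : Subgroup (𝒢.temperedPiChart h36).G),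
      IsCompact (C : Set (𝒢.temperedPiChart h36).G) →
      ∀ (j₀ : ℕ) (w : ∀ i : {i : ℕ // j₀ ≤ i}, ((𝒢.galoisLevelData h36).S i.1).orbitGraph.Vertex)
      (β β' : ∀ i : {i : ℕ // j₀ ≤ i}, ((𝒢.galoisLevelData h36).S i.1).orbitGraph.Branch),
      (∀ i, β i ≠ β' i ∧ ((𝒢.galoisLevelData h36).S i.1).orbitGraph.abuts (β i) = some (w i) ∧
        ((𝒢.galoisLevelData h36).S i.1).orbitGraph.abuts (β' i) = some (w i)) →
      (∀ ⦃i i' : {i : ℕ // j₀ ≤ i}⦄ (h : i.1 ≤ i'.1),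
        ((𝒢.galoisLevelData h36).levelTrans h).vertexMap (w i') = w i ∧
        ((𝒢.galoisLevelData h36).levelTrans h).branchMap (β i') = β i ∧
        ((𝒢.galoisLevelData h36).levelTrans h).branchMap (β' i') = β' i) →
      ∃ (Q : Type u) (_ : Group Q) (ιQ : (𝒢.temperedPiChart h36).G →* Q) (v : 𝒢.graph.Vertex)
        (b b' : 𝒢.graph.Branch) (hb : 𝒢.graph.abuts b = some v) (hb' : 𝒢.graph.abuts b' = some v)
        (ψ : 𝒢.Gv v →* Q) (x x' : 𝒢.Gv v),
        Set.InjOn ιQ C ∧ Function.Injective ψ ∧ (b' ≠ b ∨ x⁻¹ * x' ∉ 𝒢.branchSubgroup b v hb) ∧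
        ∀ g ∈ C, (∀ i,
          ((𝒢.galoisLevelData h36).levelAct h36.isCountable hconn i.1 ((MonoidHom.id _) g)).hom.vertexMap
              (w i) = w i ∧
          ((𝒢.galoisLevelData h36).levelAct h36.isCountable hconn i.1 ((MonoidHom.id _) g)).hom.branchMap
              (β i) = β i ∧
          ((𝒢.galoisLevelData h36).levelAct h36.isCountable hconn i.1 ((MonoidHom.id _) g)).hom.branchMap
              (β' i) = β' i) →
          ιQ g ∈ ((𝒢.branchSubgroup b v hb).map (MulAut.conj x).toMonoidHom).map ψ ⊓
            ((𝒢.branchSubgroup b' v hb').map (MulAut.conj x').toMonoidHom).map ψ) :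
    ∀ (C : Subgroup (𝒢.temperedPiChart h36).G), IsCompact (C : Set (𝒢.temperedPiChart h36).G) →
      ∀ (j₀ : ℕ) (w : ∀ i : {i : ℕ // j₀ ≤ i},
        (((𝒢.galoisLevelData h36).piPresentation h36.isCountable T R).cosetGraph
          ((𝒢.galoisLevelData h36).piLevelAut h36.isCountable hconn i.1).ker).Vertex)
      (β β' : ∀ i : {i : ℕ // j₀ ≤ i},
        (((𝒢.galoisLevelData h36).piPresentation h36.isCountable T R).cosetGraph
          ((𝒢.galoisLevelData h36).piLevelAut h36.isCountable hconn i.1).ker).Branch),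
      (∀ i, β i ≠ β' i ∧
        (((𝒢.galoisLevelData h36).piPresentation h36.isCountable T R).cosetGraph
          ((𝒢.galoisLevelData h36).piLevelAut h36.isCountable hconn i.1).ker).abuts (β i) = some (w i) ∧
        (((𝒢.galoisLevelData h36).piPresentation h36.isCountable T R).cosetGraph
          ((𝒢.galoisLevelData h36).piLevelAut h36.isCountable hconn i.1).ker).abuts (β' i) = some (w i)) →
      (∀ ⦃i i' : {i : ℕ // j₀ ≤ i}⦄ (h : i.1 ≤ i'.1),
        (((𝒢.galoisLevelData h36).piPresentation h36.isCountable T R).cosetGraphTrans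
            ((𝒢.galoisLevelData h36).ker_piLevelAut_anti h36.isCountable hconn h)).vertexMap (w i') = w i ∧
        (((𝒢.galoisLevelData h36).piPresentation h36.isCountable T R).cosetGraphTrans
            ((𝒢.galoisLevelData h36).ker_piLevelAut_anti h36.isCountable hconn h)).branchMap (β i') = β i ∧
        (((𝒢.galoisLevelData h36).piPresentation h36.isCountable T R).cosetGraphTrans
            ((𝒢.galoisLevelData h36).ker_piLevelAut_anti h36.isCountable hconn h)).branchMap (β' i') = β' i) →
      (∀ (i : {i : ℕ // j₀ ≤ i}) (γ : C),
        (((𝒢.galoisLevelData h36).piPresentation h36.isCountable T R).arithAct hP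
            ((𝒢.galoisLevelData h36).piLevelAut h36.isCountable hconn i.1).ker (hN i.1) (ι γ)).hom.vertexMap
            (w i) = w i ∧
        (((𝒢.galoisLevelData h36).piPresentation h36.isCountable T R).arithAct hP
            ((𝒢.galoisLevelData h36).piLevelAut h36.isCountable hconn i.1).ker (hN i.1) (ι γ)).hom.branchMap
            (β i) = β i ∧
        (((𝒢.galoisLevelData h36).piPresentation h36.isCountable T R).arithAct hP
            ((𝒢.galoisLevelData h36).piLevelAut h36.isCountable hconn i.1).ker (hN i.1) (ι γ)).hom.branchMap
            (β' i) = β' i) → C = ⊥ :=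
  (𝒢.galoisLevelData h36).hnobpCpt_cosetLevels_of_orbitLevels h36.isCountable hconn T R hP hN ι hιΦ hισ
    ((𝒢.galoisLevelData h36).hnobpCpt_orbitLevels_of_stabBranchPairCpt' h36.isCountable hconn h37
      (𝒢.temperedPiChart h36) (MonoidHom.id _) stabBranchPairCpt')

end ProfiniteSemiGraph

end Literature.AnabelianGeometry.SemiGraphs
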